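import Literature.Geometry.Riemannian.ParabolicNhdSliceVolume
import Literature.Geometry.Riemannian.ParabolicNhdComparisonChain
import HarnessLib

/-!
# Volume of metric neighbourhoods of time-slices of `P*`-parabolic neighbourhoods (Bamler 2020a,
# Thm. 9.7, display (9.9))

R. Bamler, *Entropy and heat kernel bounds on a Ricci flow background*, arXiv:2008.07093 (2020a),
§9.1, Thm. 9.7 (arXiv v1 Thm. 35), second display (9.9): for the time-slices `S_t` of
`P*(x₀, t₀; A r, −T⁻ r², T⁺ r²)` and `A' ≥ 0`,

  `|B(S_t, t, A' r)|_t ≤ C(A, A', T^±) rⁿ exp(𝒩*_{t₀ − (T⁻+α) r²}(x₀, t₀))`,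

reduced in §9.2 (last line of the proof of Thm. 35) to (9.8) by the containment
`B(S_t, t, A') × {t} ⊂ P*(x₀, t₀; A + A', −T⁻, T⁺)` (Prop. 9.3 (c): for `y ∈ B_t(x, A')`, `x ∈ S_t`,
one has `(y, t) ∈ P*((x, t); A', 0, 0)` since `d_{W₁}(δ_x, δ_y) = d_t(x, y)`). We prove the containment
(`ball_pParabolicNhdSlice_subset`) and deduce (9.9) from the tree's (9.8)
(`exists_riemVolume_pParabolicNhdSlice_le`) — `exists_riemVolume_ball_pParabolicNhdSlice_le`.
Everything is proved; no definitions, no named facts.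

## References

* R. H. Bamler, *Entropy and heat kernel bounds on a Ricci flow background*, arXiv:2008.07093
  (2020), §9.1 Thm. 9.7 (9.9); §9.2, end of the proof of Thm. 35. [Bamler2020Entropy]
-/

noncomputable section

open Set Filter Function MeasureTheory Measure
open scoped Manifold ContDiff Topology ENNReal NNReal

namespace Literature.Geometry.Riemannian

open Lorentzian Lorentzian.PseudoRiemannianMetric MetricFlow

universe u

variable {m : ℕ} {M : Type u} [TopologicalSpace M] [ChartedSpace (EuclideanSpace ℝ (Fin m)) M]
  [IsManifold 𝓘(ℝ, EuclideanSpace ℝ (Fin m)) ∞ M] [T2Space M] [CompactSpace M]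
  [SecondCountableTopology M] [MeasurableSpace M] [BorelSpace M] [ConnectedSpace M]
  {h : ℝ → PseudoRiemannianMetric 𝓘(ℝ, EuclideanSpace ℝ (Fin m)) ∞ (EuclideanSpace ℝ (Fin m))
    (TangentSpace 𝓘(ℝ, EuclideanSpace ℝ (Fin m)) : M → Type _)}
  {cov : ℝ → CovariantDerivative 𝓘(ℝ, EuclideanSpace ℝ (Fin m)) (EuclideanSpace ℝ (Fin m))
    (TangentSpace 𝓘(ℝ, EuclideanSpace ℝ (Fin m)) : M → Type _)}
  {a T : ℝ}

/-- **The metric neighbourhood of a time-slice lies in the time-slice of a larger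
`P*`-neighbourhood** (Bamler 2020a, §9.2, last line of the proof of Thm. 35:
`B(S_t, t, A') × {t} ⊂ P*(x₀, t₀; A + A', −T⁻, T⁺)`): if `x ∈ S_t`, the slice at `t` of
`P*(x₀, t₀; A, −T⁻, T⁺)` (metric flow of a compact Ricci flow, `m ≥ 1`), and `d_t(x, y) < A'`, then
`y` lies in the slice at `t` of `P*(x₀, t₀; A + A', −T⁻, T⁺)` — `(y, t) ∈ P*((x, t); A', 0, 0)` as
`d_{W₁}(δ_x, δ_y) = d_t(x, y)`, and Prop. 9.3 (c) at the fixed base time `t₀ − T⁻`.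
[cite: Bamler2020Entropy, §9.2, proof of Thm. 35, last display; §9.1, Prop. 9.3 (c)] -/
theorem ball_pParabolicNhdSlice_subset (hm : 0 < m) (hflow : IsRicciFlow h cov (Icc a T))
    (hh : IsContMDiffFamilyOn ∞ h univ) (hR : ∀ r, (h r).IsRiemannian) {t₀ t A Tm Tp A' : ℝ}
    (ht₀ : t₀ ∈ Icc a T) (ht : t ∈ Icc a T) (hTm : 0 ≤ Tm) (hb : t₀ - Tm ∈ Icc a T) {x₀ x y : M}
    (hx : x ∈ (ricciFlowMetricFlow hh hR Set.ordConnected_Icc hflow).pParabolicNhdSlice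
      ⟨⟨t₀, ht₀⟩, x₀⟩ A Tm Tp hb ⟨t, ht⟩)
    (hy : (h t).edist (hR t) x y < ENNReal.ofReal A') :
    y ∈ (ricciFlowMetricFlow hh hR Set.ordConnected_Icc hflow).pParabolicNhdSlice
      ⟨⟨t₀, ht₀⟩, x₀⟩ (A + A') Tm Tp hb ⟨t, ht⟩ := by
  set 𝒳 : MetricFlow (Icc a T) := ricciFlowMetricFlow hh hR Set.ordConnected_Icc hflow with h𝒳
  have hH := ricciFlowMetricFlow_isHConcentrated hm hh hR Set.ordConnected_Icc hflow
  -- `(x, t)` as a point of the flow, in `P*(x₀pt; A, Tm, Tp)` (definition of the slice)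
  have hxmem : (⟨⟨t, ht⟩, x⟩ : 𝒳.Pt) ∈ 𝒳.pParabolicNhd ⟨⟨t₀, ht₀⟩, x₀⟩ A Tm Tp hb := hx
  change (⟨⟨t, ht⟩, y⟩ : 𝒳.Pt) ∈ 𝒳.pParabolicNhd ⟨⟨t₀, ht₀⟩, x₀⟩ (A + A') Tm Tp hb
  have hxt := (MetricFlow.mem_pParabolicNhd_iff.1 hxmem).1
  -- `(y, t) ∈ P*((x, t); A', 0, 0)`
  have hbt : ((⟨⟨t, ht⟩, x⟩ : 𝒳.Pt).1 : ℝ) - 0 ∈ Icc a T := by simpa using ht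
  have hymem : (⟨⟨t, ht⟩, y⟩ : 𝒳.Pt) ∈ 𝒳.pParabolicNhd ⟨⟨t, ht⟩, x⟩ A' 0 0 hbt := by
    refine (MetricFlow.mem_pParabolicNhd_iff_of_coe_eq hbt (s₀ := ⟨t, ht⟩) (by simp)).2
      ⟨⟨le_rfl, by simp⟩, ?_⟩
    have h1 := 𝒳.condKernel_self (t := ⟨t, ht⟩) x
    have h2 := 𝒳.condKernel_self (t := ⟨t, ht⟩) y
    rw [h1, h2, wassersteinW1_dirac_dirac]
    refine lt_of_eq_of_lt ?_ hy
    exact PseudoRiemannianMetric.metricSpace_edist (hR t) x y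
  -- Prop. 9.3 (c) at the fixed base time `t₀ − Tm`
  have hsub := hH.pParabolicNhd_subset_of_mem' (x₁ := (⟨⟨t, ht⟩, x⟩ : 𝒳.Pt))
    (x₂ := (⟨⟨t₀, ht₀⟩, x₀⟩ : 𝒳.Pt)) (A₁ := A') (A₂ := A) (T₁ := 0) (T₂ := Tm) (T₁' := 0)
    (T₂' := Tp) (A := A + A') (T := Tm) (T' := Tp) le_rfl hTm hxmem (by linarith) le_rfl
    (by simpa using hxt.1) (by simpa using hxt.2) hbt hb
  exact hsub hymem

/-- **Bamler 2020a, Thm. 9.7, display (9.9)** (bounding the time-slice NEIGHBOURHOODS of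
`P*`-parabolic neighbourhoods): for `m ≥ 3`, `A, A', T⁺ ∈ ℝ`, `Λ ≥ 0`, `T⁻ ≥ 0`, `α > 0` there is
`C > 0` such that, in the setting of `exists_riemVolume_pParabolicNhdSlice_le` (Ricci flow of
Riemannian metrics on a closed connected `m`-manifold over `[a, T]`, scale `r > 0`, lower scalar
curvature bound `R ≥ R_min` on `[t₀ − (T⁻+α) r², t]` with `−R_min (t − (t₀ − (T⁻+α) r²)) ≤ Λ`), the
`g_t`-neighbourhood of radius `A' r` of the slice `S_t` of `P*(x₀, t₀; A r, −T⁻ r², T⁺ r²)` has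
`|B(S_t, t, A' r)|_{g_t} ≤ C rᵐ exp(𝒩_{x₀,t₀}((T⁻ + α) r²))` — (9.8) for `A + A'` and
`ball_pParabolicNhdSlice_subset`. [cite: Bamler2020Entropy, §9.1, arXiv v1 Thm. 35, (9.9); §9.2, proof] -/
theorem exists_riemVolume_ball_pParabolicNhdSlice_le (m : ℕ) (hm : 3 ≤ m) (A A' Tp : ℝ)
    {Λ Tm α : ℝ} (hΛ : 0 ≤ Λ) (hTm : 0 ≤ Tm) (hα : 0 < α) :
    ∃ C : ℝ, 0 < C ∧ ∀ {M : Type*} [TopologicalSpace M]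
      [ChartedSpace (EuclideanSpace ℝ (Fin m)) M]
      [IsManifold 𝓘(ℝ, EuclideanSpace ℝ (Fin m)) ∞ M] [T2Space M] [CompactSpace M]
      [SecondCountableTopology M] [MeasurableSpace M] [BorelSpace M] [ConnectedSpace M]
      {h : ℝ → PseudoRiemannianMetric 𝓘(ℝ, EuclideanSpace ℝ (Fin m)) ∞ (EuclideanSpace ℝ (Fin m))
        (TangentSpace 𝓘(ℝ, EuclideanSpace ℝ (Fin m)) : M → Type _)}
      {cov : ℝ → CovariantDerivative 𝓘(ℝ, EuclideanSpace ℝ (Fin m)) (EuclideanSpace ℝ (Fin m))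
        (TangentSpace 𝓘(ℝ, EuclideanSpace ℝ (Fin m)) : M → Type _)}
      {a T : ℝ} (hflow : IsRicciFlow h cov (Icc a T)) (hh : IsContMDiffFamilyOn ∞ h univ)
      (hR : ∀ r, (h r).IsRiemannian),
      ∀ {t₀ t r : ℝ} (ht₀ : t₀ ∈ Icc a T) (ht : t ∈ Icc a T) (hb : t₀ - Tm * r ^ 2 ∈ Icc a T),
      0 < r → a < t₀ - (Tm + α) * r ^ 2 → t₀ - Tm * r ^ 2 < T →
      ∀ {Rmin : ℝ}, (∀ s ∈ Icc (t₀ - (Tm + α) * r ^ 2) t, ∀ z : M,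
        Rmin ≤ (h s).scalarCurvatureWith (cov s) z) →
      -Rmin * (t - (t₀ - (Tm + α) * r ^ 2)) ≤ Λ → ∀ x₀ : M,
      (h t).riemVolume.real
          {y | ∃ x ∈ (ricciFlowMetricFlow hh hR Set.ordConnected_Icc hflow).pParabolicNhdSlice
            ⟨⟨t₀, ht₀⟩, x₀⟩ (A * r) (Tm * r ^ 2) (Tp * r ^ 2) hb ⟨t, ht⟩,
            (h t).edist (hR t) x y < ENNReal.ofReal (A' * r)} ≤
        C * r ^ m * Real.exp (pointedNashEntropy h
          (fun r' v ↦ hflow.heatKernelFn hh hR t₀ x₀ (v, r')) m t₀ (t₀ - (Tm + α) * r ^ 2)) := by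
  obtain ⟨C, hC, H98⟩ := exists_riemVolume_pParabolicNhdSlice_le m hm (A + A') Tp hΛ hTm hα
  refine ⟨C, hC, ?_⟩
  intro M _ _ _ _ _ _ _ _ _ h cov a T hflow hh hR t₀ t r ht₀ ht hb hr hs₁a hs₀T Rmin hRmin hRΛ x₀
  have hm0 : 0 < m := lt_of_lt_of_le (by norm_num) hm
  refine le_trans ?_ (H98 hflow hh hR ht₀ ht hb hr hs₁a hs₀T hRmin hRΛ x₀)
  -- monotonicity of the (finite) volume under the containment
  refine measureReal_mono (fun y hy ↦ ?_)
    ((measure_mono (subset_univ _)).trans_lt (h t).riemVolume_univ_lt_top).ne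
  · obtain ⟨x, hx, hxy⟩ := hy
    have := ball_pParabolicNhdSlice_subset hm0 hflow hh hR ht₀ ht (by positivity) hb hx hxy
    have e : A * r + A' * r = (A + A') * r := by ring
    rw [e] at this
    exact this

end Literature.Geometry.Riemannian

end
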